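import Summits.QuantumFields.BalabanUV.Beta.GAN24.CombesThomas
import Summits.QuantumFields.BalabanUV.Beta.PropagatorWoodburyFibreTarget

/-!
# `BalabanUV.Beta.GAN24.ConvCBridge` — binder row G-an2-4 / (CONV-C): the TWO typed targets of the row's provers are ONE statement
# (p3's `PropagatorWoodburyFibreTarget.ConvCResolvent` ≡ p1's `UnitDecayK ∧ CauchyDecayK` at the adopted units; and road P1's `ConvCK` implies it)

NOT IN PRINT; OUR PROOF ATTEMPT.  HONEST FRAMING (cell contract, verbatim): «discharging `BetaPertH` makes Bałaban's UV stability UNCONDITIONAL — a real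
constructive-QFT result; it is NOT the continuum limit and NOT the Clay problem.»  HONEST DEPENDENCY (verbatim): «continuum YM on T⁴ ⇐ BetaPertH ∧ nine spine
estimates (0/9 proved); BetaPertH ⇐ (D1) ∧ (D4) ∧ CAP+tail; G-an2-4 gates asym, D1 and NE2/3/4.»  [folklore] bookkeeping: two seats of one binder row typed the SAME
wall binders under two names; this file records the definitional identity and the implication from road P1's form.  No estimate, nothing instantiated, nothing
asserted.  NOT summit progress.

* `convCResolvent_iff`: `ConvCResolvent Lc C δK cK θ ↔ UnitDecayK 3 Lc (sfStep Lc) (smStep 3 Lc) C δK ∧ CauchyDecayK 3 Lc (sfStep Lc) (smStep 3 Lc) cK θ δK`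
  (`Iff.rfl` up to the two seats' copies of `s_f j = Lc^j`, `s_m j = Lc^{4j}`, which are the same terms).
* `convCResolvent_of_unitDecayK_supRateK`: road P1's pair (uniform decay + ONE-STEP SUP-NORM rate) gives p3's `ConvCResolvent Lc C (δ/2) √(2(c/(1−θ))C) √θ`
  (`GAN24/CombesThomas.cauchyDecayK_of_unitDecayK_supRateK` + `unitDecayK_half`).
* `convCKWall_of_convCResolvent` / `convCResolvent_exists_of_convCK`: the existential packagings agree.
-/

open Literature.MathematicalPhysics.QuantumFieldTheory.Balaban1983to89.Beta
open Summit.QuantumFields.BalabanUV.Beta.GAN24.CombesThomas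
open Summit.QuantumFields.BalabanUV.Beta.PropagatorWoodburyFibreTarget (ConvCResolvent)

namespace Summit.QuantumFields.BalabanUV.Beta.GAN24.ConvCBridge

variable {Lc : ℕ} [NeZero Lc]

omit [NeZero Lc] in
/-- [folklore] The two seats' field units coincide: `PropagatorWoodburyFibreTarget.sfStep = GAN24.CombesThomas.sfStep`. -/
theorem sfStep_eq : PropagatorWoodburyFibreTarget.sfStep Lc = CombesThomas.sfStep Lc := rfl

omit [NeZero Lc] in
/-- [folklore] The two seats' multiplier units coincide at `d = 3`: `PropagatorWoodburyFibreTarget.smStep = GAN24.CombesThomas.smStep 3`. -/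
theorem smStep_eq : PropagatorWoodburyFibreTarget.smStep Lc = CombesThomas.smStep 3 Lc := rfl

/-- [folklore] **ONE STATEMENT, TWO NAMES**: p3's `ConvCResolvent Lc C δK cK θ` IS p1's `UnitDecayK ∧ CauchyDecayK` at the adopted units `(Lc^j, Lc^{4j})`. -/
theorem convCResolvent_iff {C δK cK θ : ℝ} :
    ConvCResolvent Lc C δK cK θ ↔
      UnitDecayK 3 Lc (CombesThomas.sfStep Lc) (CombesThomas.smStep 3 Lc) C δK ∧
        CauchyDecayK 3 Lc (CombesThomas.sfStep Lc) (CombesThomas.smStep 3 Lc) cK θ δK :=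
  Iff.rfl

/-- [folklore] **ROAD P1 ⇒ p3's TARGET**: uniform decay + a one-step sup-norm rate (`0 ≤ θ < 1`) give `ConvCResolvent` with rate `√θ`, decay `δ/2`,
constant `√(2(c/(1−θ))C)` (`GAN24/CombesThomas.cauchyDecayK_of_unitDecayK_supRateK`, `unitDecayK_half`). -/
theorem convCResolvent_of_unitDecayK_supRateK {C δ c θ : ℝ}
    (hK : UnitDecayK 3 Lc (CombesThomas.sfStep Lc) (CombesThomas.smStep 3 Lc) C δ)
    (hS : SupRateK 3 Lc (CombesThomas.sfStep Lc) (CombesThomas.smStep 3 Lc) c θ) (hδ : 0 ≤ δ) (hθ0 : 0 ≤ θ) (hθ1 : θ < 1) :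
    ConvCResolvent Lc C (δ / 2) (Real.sqrt (2 * (c / (1 - θ)) * C)) (Real.sqrt θ) :=
  convCResolvent_iff.2 ⟨unitDecayK_half hK hδ, cauchyDecayK_of_unitDecayK_supRateK hK hS hθ0 hθ1⟩

/-- [folklore] p3's target with `0 < δK`, `0 ≤ θ < 1` is an inhabitant of p1's wall-form package `ConvCKWall 3 Lc`. -/
theorem convCKWall_of_convCResolvent {C δK cK θ : ℝ} (h : ConvCResolvent Lc C δK cK θ) (hδ : 0 < δK) (hθ0 : 0 ≤ θ) (hθ1 : θ < 1) :
    ConvCKWall 3 Lc :=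
  ⟨C, δK, cK, θ, hδ, hθ0, hθ1, h.1, h.2⟩

/-- [folklore] Road P1's package `ConvCK 3 Lc` yields SOME instance of p3's target (with `0 < δK`, `0 ≤ θ < 1`). -/
theorem convCResolvent_exists_of_convCK (h : ConvCK 3 Lc) :
    ∃ C δK cK θ : ℝ, 0 < δK ∧ 0 ≤ θ ∧ θ < 1 ∧ ConvCResolvent Lc C δK cK θ := by
  obtain ⟨C, δ, cK, θ, hδ, hθ0, hθ1, hK, hKall⟩ := convCKWall_of_convCK h
  exact ⟨C, δ, cK, θ, hδ, hθ0, hθ1, convCResolvent_iff.2 ⟨hK, hKall⟩⟩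

end Summit.QuantumFields.BalabanUV.Beta.GAN24.ConvCBridge
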